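import Summits.BirchSwinnertonDyer.Rank1Residual.P2.CongruentNumberSilentEvenFiveThetaCMGalois
import Literature.NumberTheory.EllipticCurves.TianYuanZhang2017.CMPointClassFieldProofs
import HarnessLib
import HarnessLib.Audit.Tags

/-!
# Cell `bsd-monsky`, route B: C-P2-1 on `𝒮⁻` relative to {`tyz_cmPointClassFieldData`, Aoki 1999 Thm. 2.2} — the
# route-B corner with its genus-theory / ring-class-field READINGS SPLIT into printed sentences (kernel theorems;
# nothing asserted)

HONEST FRAMING (cell `bsd-monsky`, run/shared/lean/pub/bsd-monsky/; README §1): the cell's claimed theorem is Monsky's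
1990 conjecture on `𝒮⁻ = {2pq : p ≡ 5 (8), q ≡ 3 (4), (q/p) = −1}` — `ord_{s=1} L(E_{2pq}, s) = 1` and the `2`-part of
BSD; PASS by two AI referee lines on the written proofs, pending independent expert review; nothing is booked by this
file.  Route B's corner of record (referee B ROUND 253) is
`congruentSilentEvenFiveBSDTwo_of_cmPointGaloisData_of_aoki (hCM) (hAo)` (`…ThetaCMGalois.lean`), LITERAL-by-name
with marks `reading@{G3b, G5a, genusField-Cox-6.1@(G2 d≡5, G4b, G9)}`: five conjuncts of the Literature display
`tyz_cmPointGaloisData` are one-line readings of print through Cox's Theorem 6.1 (ii) (genus field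
`= K(√p₁*, …, √p_r*)`) and Lemma 9.3 / Theorem 9.18 (subfields of ring class fields are generalized dihedral over `ℚ`).

THIS file re-runs the corner and its twins on the SPLIT display `tyz_cmPointClassFieldData`
(`Literature/…/TianYuanZhang2017/CMPointClassFieldDisplays.lean`): the same TYZ §3 layer with the genus fields `L_d`
NAMED (fixing groups), the two notions «genus field of `K_d`» / «contained in a ring class field of `K_d`» carried as
abstract predicates, TYZ's sentences Prop. 3.2 (1)(2) («`H′_n(√2)` / `H′_n` is the ring class field of conductor `4`
over `K_n`») and p. 759 («the genus field `L_n` is the subfield of `H_n` fixed by `2Cl_n`», «… of `H′_n` fixed by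
`2Cl′_n` is `L_n, L_n(i), L_n`», «`Z(n)` is already defined over `L_n`») displayed on them, and Cox's Theorem 6.1 (ii)
and Theorem 9.18 displayed VERBATIM as universal sentences; the five conjuncts are KERNEL THEOREMS of those sentences
(`Literature/…/CMPointClassFieldProofs.lean`: `tyz_cmPointGaloisData_of_cmPointClassFieldData`).  So every door below
is a one-line composition with `…ThetaCMGalois.lean`; the displayed inputs of route B become {TYZ §3 sentences + Cox
Thm. 6.1 (ii) + Cox Thm. 9.18 (all printed), Aoki Thm. 2.2}.  No mark is moved by this file alone (the referee's word on
the split is the cell's business); nothing is asserted; no `_holds`.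
[cite: TianYuanZhang2017, §3.1 (J738–J739), Prop. 3.2 (1)(2)(3), Thm. 3.5, Thm. 3.6 (J741), Lemma 3.21 and its proof (J759)]
[cite: Cox2013, Theorem 6.1 (ii) and Theorem 9.18] [cite: Aoki1999, Thm. 2.2 (p. 81)]
[cite: Monsky1990MockHeegner, Remark (3) (p. 67)]
-/


noncomputable section

open scoped Classical

open WeierstrassCurve NumberField Literature.NumberTheory.EllipticCurves
  Literature.NumberTheory.EllipticCurves.TianYuanZhang2017 Literature.NumberTheory.EllipticCurves.Aoki1999
  Literature.NumberTheory.EllipticCurves.HeathBrown1994 Literature.NumberTheory.QuadraticFields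

namespace Summit.BirchSwinnertonDyer.Rank1Residual.P2

open ThetaDescent Conjectures

/-! ## §1 The split display feeds route B's printed display -/

/-- **Route B's printed display `thetaCMPrintedDatum p q` for every `p ≡ 5 (mod 8)`, `q ≡ 3 (mod 4)` from the split
Literature display `tyz_cmPointClassFieldData`** (through `tyz_cmPointGaloisData_of_cmPointClassFieldData`, the kernel
derivation of the five class-field conjuncts). [cite: TianYuanZhang2017, §3.1, Prop. 3.2, Thm. 3.6, proof of Lemma 3.21 (J759)]
[cite: Cox2013, Theorem 6.1 (ii) and Theorem 9.18] -/
theorem thetaPrinted_of_cmPointClassFieldData (hCF : tyz_cmPointClassFieldData) :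
    ∀ p q : ℕ, p.Prime → q.Prime → p % 8 = 5 → q % 4 = 3 → thetaCMPrintedDatum p q :=
  thetaPrinted_of_cmPointGaloisData (tyz_cmPointGaloisData_of_cmPointClassFieldData hCF)

/-- And the original route-B display `K_B = thetaGenusPointDatum` for all pairs. [cite: TianYuanZhang2017, §3]
[cite: Cox2013, Theorem 6.1 (ii) and Theorem 9.18] -/
theorem thetaDisplay_of_cmPointClassFieldData (hCF : tyz_cmPointClassFieldData) :
    ∀ p q : ℕ, p.Prime → q.Prime → p % 8 = 5 → q % 4 = 3 → thetaGenusPointDatum p q :=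
  thetaDisplay_of_cmPointGaloisData (tyz_cmPointGaloisData_of_cmPointClassFieldData hCF)

/-! ## §2 Doors: clause (a) and C-P2-1 on `𝒮⁻`, the `q ≡ 3 (8)` rows, the whole even-five family, the `k = 2` rung -/

/-- **Clause (a) on `𝒮⁻` from ONE Literature display whose every conjunct is a printed sentence**: `ord_{s=1} L(E_{2pq}, s)
= 1` for every `(p, q) ∈ 𝒮⁻`, relative to `tyz_cmPointClassFieldData` alone (no Selmer input, no GZK binder; `g(2pq)` odd
and Rédei–Reichardt are tree theorems). CONDITIONAL; nothing asserted.
[cite: TianYuanZhang2017, Thm. 3.5, Prop. 3.2, Thm. 3.6, Lemma 3.21] [cite: Cox2013, Theorem 6.1 (ii) and Theorem 9.18] -/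
theorem analyticRank_eq_one_sMinus_of_cmPointClassFieldData (hCF : tyz_cmPointClassFieldData)
    {p q : ℕ} (hp : p.Prime) (hq : q.Prime) (hp5 : p % 8 = 5) (hq4 : q % 4 = 3) (hj : jacobiSym p q = -1) :
    (congruentNumberCurve (2 * (p * q))).analyticRank = 1 :=
  analyticRank_eq_one_sMinus_of_thetaPrinted (thetaPrinted_of_cmPointClassFieldData hCF) hp hq hp5 hq4 hj

/-- **C-P2-1, sharper (`Ш_an`-unit) form, on all of `𝒮⁻` from {`tyz_cmPointClassFieldData`, Aoki 1999 Thm. 2.2}.**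
CONDITIONAL; nothing asserted. [cite: Aoki1999, Thm. 2.2 p. 81] [cite: TianYuanZhang2017, Thm. 3.5, Prop. 3.2, Thm. 3.6]
[cite: Cox2013, Theorem 6.1 (ii) and Theorem 9.18] -/
theorem congruentSilentEvenFiveOrdTwo_of_cmPointClassFieldData_of_aoki (hCF : tyz_cmPointClassFieldData)
    (hAo : thm22_card_selmerGroup_two) : CongruentSilentEvenFiveOrdTwo :=
  congruentSilentEvenFiveOrdTwo_of_cmPointGaloisData_of_aoki (tyz_cmPointGaloisData_of_cmPointClassFieldData hCF) hAo

/-- **THE CORNER WITH THE READINGS SPLIT.  C-P2-1, OBSERVABLE form (`ord_{s=1} L(E_{2pq}, s) = 1 ∧ BSD(E_{2pq}, 2)` on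
all of `𝒮⁻`) from exactly TWO Literature named facts {`tyz_cmPointClassFieldData` (TYZ §3 sentences with the genus
fields named + Cox Thm. 6.1 (ii) + Cox Thm. 9.18, every displayed sentence printed), `Aoki1999.thm22_card_selmerGroup_two`
(Aoki Thm. 2.2)}** — no Summits-side obligation node, no Tian-2014 system, no Monsky 1990, no HB94, no GZK binder, no
Rédei–Reichardt binder. CONDITIONAL; nothing asserted; no mark moved by this file alone.
[cite: Aoki1999, Thm. 2.2 p. 81] [cite: TianYuanZhang2017, Thm. 3.5, Prop. 3.2 (1)(2)(3), Thm. 3.6, Lemma 3.21]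
[cite: Cox2013, Theorem 6.1 (ii) and Theorem 9.18] -/
theorem congruentSilentEvenFiveBSDTwo_of_cmPointClassFieldData_of_aoki (hCF : tyz_cmPointClassFieldData)
    (hAo : thm22_card_selmerGroup_two) : CongruentSilentEvenFiveBSDTwo :=
  congruentSilentEvenFiveBSDTwo_of_cmPointGaloisData_of_aoki (tyz_cmPointGaloisData_of_cmPointClassFieldData hCF) hAo

/-- **C-P2-1, observable form, from {`tyz_cmPointClassFieldData`, `hMe`}** (Heath-Brown 1994 / Monsky's even `2`-Selmer
count instead of Aoki). CONDITIONAL; nothing asserted. [cite: HeathBrown1994SelmerCongruentII, Appendix (Monsky) p. 41 L20–L36]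
[cite: TianYuanZhang2017, Thm. 3.5, Prop. 3.2, Thm. 3.6] [cite: Cox2013, Theorem 6.1 (ii) and Theorem 9.18] -/
theorem congruentSilentEvenFiveBSDTwo_of_cmPointClassFieldData_of_monskyEven (hCF : tyz_cmPointClassFieldData)
    (hMe : monsky_card_selmerGroup_two_even) : CongruentSilentEvenFiveBSDTwo :=
  congruentSilentEvenFiveBSDTwo_of_cmPointGaloisData_of_monskyEven
    (tyz_cmPointGaloisData_of_cmPointClassFieldData hCF) hMe

/-- **`ord_{s=1} L(E_{2pq}, s) = 1 ∧ BSD(E_{2pq}, 2)` for every `p ≡ 5 (mod 8)`, `q ≡ 3 (mod 8)`, EITHER symbol**, from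
{`tyz_cmPointClassFieldData`, Aoki 1999 Thm. 2.2}. CONDITIONAL; nothing asserted. [cite: Aoki1999, Thm. 2.2 p. 81]
[cite: TianYuanZhang2017, Thm. 3.5, Prop. 3.2, Thm. 3.6] [cite: Cox2013, Theorem 6.1 (ii) and Theorem 9.18] -/
theorem analyticRank_eq_one_and_bsdp_two_three_mod_eight_of_cmPointClassFieldData_of_aoki
    (hCF : tyz_cmPointClassFieldData) (hAo : thm22_card_selmerGroup_two) {p q : ℕ} (hp : p.Prime) (hq : q.Prime)
    (hp5 : p % 8 = 5) (hq3 : q % 8 = 3) :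
    (congruentNumberCurve (2 * (p * q))).analyticRank = 1 ∧ BSDp (congruentNumberCurve (2 * (p * q))) 2 :=
  analyticRank_eq_one_and_bsdp_two_three_mod_eight_of_cmPointGaloisData_of_aoki
    (tyz_cmPointGaloisData_of_cmPointClassFieldData hCF) hAo hp hq hp5 hq3

/-- **`ord_{s=1} L(E_{2pq}, s) = 1 ∧ BSD(E_{2pq}, 2)` for ALL primes `p ≡ 5 (mod 8)`, `q ≡ 3 (mod 4)` from THREE binders
{`tyz_cmPointClassFieldData`, GZK, Aoki 1999 Thm. 2.2}** (on `(p/q) = +1` Tian–Yuan–Zhang's own descent through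
`tyz_genusPointData_of_cmPointClassFieldData`, on `(p/q) = −1` route B). CONDITIONAL; nothing asserted.
[cite: TianYuanZhang2017, Thm. 1.2, Thm. 3.5, Prop. 3.2, Thm. 3.6] [cite: Aoki1999, Thm. 2.2 p. 81]
[cite: Cox2013, Theorem 6.1 (ii) and Theorem 9.18] -/
theorem analyticRank_eq_one_and_bsdp_two_of_cmPointClassFieldData_of_aoki (hCF : tyz_cmPointClassFieldData)
    (hGZK : rank_eq_analyticRank_of_analyticRank_le_one) (hAo : thm22_card_selmerGroup_two)
    {p q : ℕ} (hp : p.Prime) (hq : q.Prime) (hp5 : p % 8 = 5) (hq4 : q % 4 = 3) :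
    (congruentNumberCurve (2 * (p * q))).analyticRank = 1 ∧ BSDp (congruentNumberCurve (2 * (p * q))) 2 :=
  analyticRank_eq_one_and_bsdp_two_of_cmPointGaloisData_of_aoki
    (tyz_cmPointGaloisData_of_cmPointClassFieldData hCF) hGZK hAo hp hq hp5 hq4

/-- **`BSD(E_{2pq}, 2)` on the whole even-five family** from {`tyz_cmPointClassFieldData`, GZK, Aoki 1999 Thm. 2.2} (the
shape of the consumer door `forall_bsdp_two_congruentNumberCurve_two_mul_five_mul`). CONDITIONAL; nothing asserted.
[cite: TianYuanZhang2017, Thm. 1.2, Thm. 3.5, Prop. 3.2, Thm. 3.6] [cite: Aoki1999, Thm. 2.2 p. 81]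
[cite: Cox2013, Theorem 6.1 (ii) and Theorem 9.18] -/
theorem forall_bsdp_two_congruentNumberCurve_two_mul_five_mul_of_cmPointClassFieldData_of_aoki
    (hCF : tyz_cmPointClassFieldData) (hGZK : rank_eq_analyticRank_of_analyticRank_le_one)
    (hAo : thm22_card_selmerGroup_two) :
    ∀ p q : ℕ, p.Prime → q.Prime → p % 8 = 5 → q % 4 = 3 → BSDp (congruentNumberCurve (2 * (p * q))) 2 :=
  forall_bsdp_two_congruentNumberCurve_two_mul_five_mul_of_cmPointGaloisData_of_aoki
    (tyz_cmPointGaloisData_of_cmPointClassFieldData hCF) hGZK hAo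

/-- **THE SILENT `k = 2` RUNG of the typed uniform law from {`tyz_cmPointClassFieldData`, Aoki Thm. 2.2}** — two
Literature named facts, every displayed sentence printed. Conditional; nothing asserted.
[cite: Monsky1990MockHeegner, Remark (3) (p. 67)] [cite: TianYuanZhang2017, Prop. 3.2, Thm. 3.6, Thm. 3.5]
[cite: Aoki1999, Thm. 2.2 (p. 81)] [cite: Cox2013, Theorem 6.1 (ii) and Theorem 9.18] -/
theorem congruentSilentEvenBSDTwoAt_two_of_cmPointClassFieldData_of_aoki (hCF : tyz_cmPointClassFieldData)
    (hAo : thm22_card_selmerGroup_two) : CongruentSilentEvenBSDTwoAt 2 :=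
  congruentSilentEvenBSDTwoAt_two_of_cmPointGaloisData_of_aoki (tyz_cmPointGaloisData_of_cmPointClassFieldData hCF) hAo

/-- **THE `k = 2` RUNG `CongruentEvenBSDTwoAt 2` (silent AND loud cells) from {`tyz_cmPointClassFieldData`, GZK, `hMe`}.**
Conditional; nothing asserted. [cite: Monsky1990MockHeegner, Remark (3) (p. 67)]
[cite: TianYuanZhang2017, Thm. 1.2, Thm. 3.5, Prop. 3.2, Thm. 3.6] [cite: HeathBrown1994SelmerCongruentII, Appendix (Monsky)]
[cite: Cox2013, Theorem 6.1 (ii) and Theorem 9.18] -/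
theorem congruentEvenBSDTwoAt_two_of_cmPointClassFieldData_of_monskyEven (hCF : tyz_cmPointClassFieldData)
    (hGZK : rank_eq_analyticRank_of_analyticRank_le_one) (hMe : monsky_card_selmerGroup_two_even) :
    CongruentEvenBSDTwoAt 2 :=
  congruentEvenBSDTwoAt_two_of_cmPointGaloisData_of_monskyEven (tyz_cmPointGaloisData_of_cmPointClassFieldData hCF)
    hGZK hMe

end Summit.BirchSwinnertonDyer.Rank1Residual.P2

end
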